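import Mathlib.AlgebraicGeometry.AffineScheme
import Literature.RingTheory.Smooth.AugmentationIdealCotangentLocalization
import HarnessLib

/-!
# The conormal module of a section of an `R`-scheme on an affine chart, its endomorphisms, and the charts of a fibre

Topic `Literature/AlgebraicGeometry/Morphisms`, namespace `Literature.AlgebraicGeometry.Morphisms`.  DEFINITIONS (a type
synonym with its algebra structure, an augmentation, an endomorphism, a ring isomorphism) and THEOREMS; no named fact
(net debt 0).  Sequel of `RingTheory/Smooth/AugmentationIdealCotangent{BaseChange,Localization}` (the algebra) and of
`Morphisms/AffineBaseChangeChart` (charts of a base change); brick G3b-1 of cell `hodgecm-mathlib`, row II-2β (the type of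
the specialisation of a CM abelian scheme, read on the conormal module of the unit section).

THE PRINT.  Görtz–Wedhorn, *Algebraic Geometry II*, (17.3)–Remark 17.15: for a section `e : S = Spec R → X` of an
`R`-scheme `f : X → Spec R` landing in an affine open `W = Spec Γ(X, W)`, `e` is a closed immersion into `W` with ideal
`I = ker (e^♯ : Γ(X, W) → R)`, and its CONORMAL MODULE is `𝒞_e = I/I²`, an `R`-module which «does not depend on the choice
of» `W` ((17.3), after (17.3.1)); it is functorial along commutative squares (Remark 17.14: `w_{i',i}`), and for a
CARTESIAN square — a base change `Spec T → Spec R` — the comparison `g^* 𝒞_e → 𝒞_{e_T}` is surjective (Remark 17.15 (1)),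
the charts of the base change being `Γ(pr⁻¹ W) = T ⊗_R Γ(X, W)` (Görtz–Wedhorn I, Prop. 4.20 / Stacks 01JO;
`Morphisms/AffineBaseChangeChart`).

WHAT IS HERE (`f : X ⟶ Spec R`, `e` a section, `W` an affine open with `e⁻¹ W = ⊤`):
* §1 `ChartRing f W` — the coordinate ring `Γ(X, W)` as an `R`-ALGEBRA (through `f^♯`), a type synonym carrying the
  instances; `sectionAug f e he heW : ChartRing f W →ₐ[R] R` — the augmentation `e^♯`; so the conormal module of the
  section on the chart is `(augIdeal (sectionAug …)).Cotangent` of `RingTheory/Smooth`.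
* §2 Basic opens: for `h ∈ Γ(X, W)` with `e^♯ h = 1` the section lands in `D(h)` (`preimage_basicOpen_eq_top`),
  `ChartRing f (X.basicOpen h)` is an `IsLocalization.Away h` of `ChartRing f W` compatibly with the augmentations
  (`sectionAug_algebraMap`), and **`exists_sectionAug_eq_one_and_basicOpen_le`**: every open `O ⊇ e(Spec R)` contains such
  a `D(h)` (the section is `V(I)` in `Spec Γ(X, W)`, and `V(I) ∩ V(J) = ∅` forces `I + J = (1)`).
* §3 An `R`-endomorphism `v` of `X` fixing the section (`e ≫ v = e`) acts on the conormal module although it need not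
  preserve `W`: through `v^♯ : Γ(X, W) → Γ(X, D(h))` for `D(h) ⊆ v⁻¹ W` (`restrictAlgHom`) and the isomorphism
  `I/I² ≅ I_h/I_h²` of `AugmentationIdealCotangentLocalization`: **`sectionConormalEndo`** (Görtz–Wedhorn II, Remark 17.14).
The sequels: `Morphisms/FibreChartRing` (the charts `Γ(Y, p⁻¹W) = T ⊗_R Γ(X, W)` of a FIBRE `Y = X ×_R T`) and
`Motives/AbelianVarietyCotangentOfFibre` (the cotangent space at the origin of an abelian-variety fibre read through them).

## References
* [GortzWedhorn2023] U. Görtz, T. Wedhorn, *Algebraic Geometry II* (2023), (17.3) (17.3.1), Remark 17.14, Remark 17.15 (1).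
* [GortzWedhorn2020] U. Görtz, T. Wedhorn, *Algebraic Geometry I*, 2nd ed. (2020), Prop. 4.20, Thm. 4.18.
* [StacksProject] The Stacks Project, Tag 01JO.
-/

noncomputable section

-- `TopCat.Presheaf` is not reducible (as in Mathlib's `AlgebraicGeometry/Modules` and `Morphisms/AffineBaseChangeChart`).
set_option backward.isDefEq.respectTransparency false

open CategoryTheory AlgebraicGeometry TopologicalSpace Opposite
open Literature.RingTheory.Smooth

universe u

namespace Literature.AlgebraicGeometry.Morphisms

variable {R : Type u} [CommRing R] {X : Scheme.{u}} (f : X ⟶ Spec (.of R))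

/-! ## §1 The coordinate ring of a chart as an `R`-algebra; the augmentation of a section -/

/-- **`Γ(X, W)` as an `R`-algebra** through `f^♯ : R = Γ(Spec R) → Γ(X, ⊤) → Γ(X, W)`, for an `R`-scheme `f : X → Spec R`
and an open `W ⊆ X` (a type synonym of `Γ(X, W)` carrying the algebra structure; `ChartRing.val` / `ChartRing.mk` are the
identity casts). [cite: GortzWedhorn2020, §(3.2) and Prop. 3.4 (morphisms to affine schemes)] -/
def ChartRing (_f : X ⟶ Spec (.of R)) (W : X.Opens) : Type u := Γ(X, W)

namespace ChartRing

variable (W : X.Opens)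

/-- The ring structure of `Γ(X, W)`. [cite: GortzWedhorn2020, §(3.2)] -/
instance instCommRing : CommRing (ChartRing f W) := inferInstanceAs (CommRing Γ(X, W))

variable {f W} in
/-- The identity cast `ChartRing f W → Γ(X, W)`. [cite: GortzWedhorn2020, §(3.2)] -/
def val : ChartRing f W →+* Γ(X, W) := RingHom.id _

/-- The identity cast `Γ(X, W) → ChartRing f W`. [cite: GortzWedhorn2020, §(3.2)] -/
def mk : Γ(X, W) →+* ChartRing f W := RingHom.id _

/-- `val (mk x) = x`. [cite: GortzWedhorn2020, §(3.2)] -/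
@[simp] theorem val_mk (x : Γ(X, W)) : val (mk f W x) = x := rfl

/-- `mk (val s) = s`. [cite: GortzWedhorn2020, §(3.2)] -/
@[simp] theorem mk_val (s : ChartRing f W) : mk f W (val s) = s := rfl

/-- `val` is injective (it is the identity). [cite: GortzWedhorn2020, §(3.2)] -/
theorem val_injective : Function.Injective (val (f := f) (W := W)) := fun _ _ h => h

/-- The `R`-algebra structure `r ↦ f^♯(r)|_W`. [cite: GortzWedhorn2020, §(3.2)] -/
instance instAlgebra : Algebra R (ChartRing f W) :=
  ((mk f W).comp ((Scheme.ΓSpecIso (.of R)).inv ≫ f.appLE ⊤ W le_top).hom).toAlgebra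

/-- Unfolding the structure map: `algebraMap R Γ(X, W) r = f^♯_{⊤ ≤ W} (r)`. [cite: GortzWedhorn2020, §(3.2)] -/
theorem val_algebraMap (r : R) :
    val (algebraMap R (ChartRing f W) r) = f.appLE ⊤ W le_top ((Scheme.ΓSpecIso (.of R)).inv r) :=
  rfl

end ChartRing

open ChartRing

/-! ### Applied forms of Mathlib's `appLE` composition lemmas -/

section AppLE

variable {X' Y Z : Scheme.{u}}

/-- `f^♯_{V ≤ W} (g^♯_{U ≤ V} x) = (f ≫ g)^♯_{U ≤ W} x` (Mathlib `Scheme.Hom.appLE_comp_appLE`, applied). [folklore] -/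
private theorem appLE_appLE_apply (f : X' ⟶ Y) (g : Y ⟶ Z) (U : Z.Opens) (V : Y.Opens) (W : X'.Opens)
    (e₁ : V ≤ g ⁻¹ᵁ U) (e₂ : W ≤ f ⁻¹ᵁ V) (x : Γ(Z, U)) :
    f.appLE V W e₂ (g.appLE U V e₁ x) = (f ≫ g).appLE U W (e₂.trans ((Opens.map f.base).map (homOfLE e₁)).le) x := by
  have := congrArg (fun φ => φ.hom x) (Scheme.Hom.appLE_comp_appLE f g U V W e₁ e₂)
  simpa only [CommRingCat.hom_comp, RingHom.comp_apply] using this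

/-- `f^♯_{U ≤ V} (res x) = f^♯_{U' ≤ V} x` (Mathlib `Scheme.Hom.map_appLE`, applied). [folklore] -/
private theorem map_appLE_apply (f : X' ⟶ Y) {U U' : Y.Opens} {V : X'.Opens} (e : V ≤ f ⁻¹ᵁ U) (i : op U' ⟶ op U)
    (x : Γ(Y, U')) :
    f.appLE U V e (Y.presheaf.map i x) = f.appLE U' V (e.trans ((Opens.map f.base).map i.unop).le) x := by
  have := congrArg (fun φ => φ.hom x) (Scheme.Hom.map_appLE f e i)
  simpa only [CommRingCat.hom_comp, RingHom.comp_apply] using this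

/-- `res (f^♯_{U ≤ V} x) = f^♯_{U ≤ V'} x` (Mathlib `Scheme.Hom.appLE_map`, applied). [folklore] -/
private theorem appLE_map_apply (f : X' ⟶ Y) {U : Y.Opens} {V V' : X'.Opens} (e : V ≤ f ⁻¹ᵁ U) (i : op V ⟶ op V')
    (x : Γ(Y, U)) :
    X'.presheaf.map i (f.appLE U V e x) = f.appLE U V' (i.unop.le.trans e) x := by
  have := congrArg (fun φ => φ.hom x) (Scheme.Hom.appLE_map f e i)
  simpa only [CommRingCat.hom_comp, RingHom.comp_apply] using this

/-- `appLE` along equal morphisms. [folklore] -/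
private theorem appLE_congr_hom {g g' : Y ⟶ Z} (hg : g = g') (U : Z.Opens) (V : Y.Opens)
    (hUV : V ≤ g ⁻¹ᵁ U) : g.appLE U V hUV = g'.appLE U V (hg ▸ hUV) := by
  subst hg; rfl

/-- `(𝟙 Y)^♯_{⊤ ≤ ⊤} = id`. [folklore] -/
private theorem id_appLE_top_apply (hle : (⊤ : Y.Opens) ≤ (𝟙 Y) ⁻¹ᵁ ⊤) (x : Γ(Y, ⊤)) :
    Scheme.Hom.appLE (𝟙 Y) ⊤ ⊤ hle x = x := by
  change Scheme.Hom.appLE (𝟙 Y) ⊤ ((𝟙 Y) ⁻¹ᵁ ⊤) le_rfl x = x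
  rw [Scheme.Hom.appLE_eq_app, Scheme.Hom.id_app]
  rfl

end AppLE

section Section

variable (e : Spec (.of R) ⟶ X) (he : e ≫ f = 𝟙 _) {W : X.Opens} (heW : e ⁻¹ᵁ W = ⊤)

include he in
/-- **`e^♯ ∘ f^♯ = id`** on the chart: `e^♯_{W}(f^♯_{W}(x)) = x` for `x ∈ Γ(Spec R, ⊤)` (`e` is a section of `f`).
[cite: GortzWedhorn2023, (17.3)] -/
theorem appLE_section_apply (x : Γ(Spec (.of R), ⊤)) :
    e.appLE W ⊤ heW.ge (f.appLE ⊤ W le_top x) = x := by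
  rw [appLE_appLE_apply, appLE_congr_hom he, id_appLE_top_apply]

/-- **The augmentation `e^♯ : Γ(X, W) → R` of a section** `e` of `f : X → Spec R` landing in the open `W` (`e⁻¹W = ⊤`),
as an `R`-algebra map; its kernel `augIdeal (sectionAug …)` is the ideal of the closed subscheme `e(Spec R) ⊆ W` and
`(augIdeal (sectionAug …)).Cotangent` is the conormal module `𝒞_e = I/I²` of the section.
[cite: GortzWedhorn2023, (17.3) (17.3.1)] -/
def sectionAug : ChartRing f W →ₐ[R] R where
  toRingHom := (e.appLE W ⊤ heW.ge ≫ (Scheme.ΓSpecIso (.of R)).hom).hom.comp val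
  commutes' r := by
    change (Scheme.ΓSpecIso (.of R)).hom (e.appLE W ⊤ heW.ge (val (algebraMap R (ChartRing f W) r))) = r
    rw [val_algebraMap, appLE_section_apply f e he heW, ← CommRingCat.comp_apply, Iso.inv_hom_id]
    rfl

/-- Unfolding: `sectionAug s = ΓSpecIso (e^♯_{W ≤ ⊤} s)`. [cite: GortzWedhorn2023, (17.3)] -/
theorem sectionAug_apply (s : ChartRing f W) :
    sectionAug f e he heW s = (Scheme.ΓSpecIso (.of R)).hom (e.appLE W ⊤ heW.ge (val s)) :=
  rfl

/-- `sectionAug s = 0 ↔ e^♯ s = 0`. [cite: GortzWedhorn2023, (17.3)] -/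
theorem sectionAug_eq_zero_iff (s : ChartRing f W) : sectionAug f e he heW s = 0 ↔ e.appLE W ⊤ heW.ge (val s) = 0 := by
  rw [sectionAug_apply]
  refine ⟨fun h => ?_, fun h => by rw [h, map_zero]⟩
  have := congrArg (Scheme.ΓSpecIso (.of R)).inv h
  rwa [← CommRingCat.comp_apply, Iso.hom_inv_id, map_zero] at this

/-! ## §2 Basic opens containing the section -/

/-- **If `e^♯(h) = 1` the section lands in `D(h)`**: `e⁻¹ D(h) = ⊤`. [cite: GortzWedhorn2023, (17.3)] -/
theorem preimage_basicOpen_eq_top (h : ChartRing f W) (hh : sectionAug f e he heW h = 1) :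
    e ⁻¹ᵁ X.basicOpen (val h) = ⊤ := by
  have h1 : e.appLE W ⊤ heW.ge (val h) = 1 := by
    have := congrArg (Scheme.ΓSpecIso (.of R)).inv hh
    rwa [sectionAug_apply, ← CommRingCat.comp_apply, Iso.hom_inv_id, map_one] at this
  have h2 : (Spec (.of R)).basicOpen (e.appLE W ⊤ heW.ge (val h)) = ⊤ :=
    Scheme.basicOpen_of_isUnit _ (h1 ▸ isUnit_one)
  rw [Scheme.Hom.appLE, CommRingCat.comp_apply, Scheme.basicOpen_res] at h2
  rw [Scheme.preimage_basicOpen]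
  exact top_le_iff.1 (h2.ge.trans inf_le_right)

namespace ChartRing

/-- `Γ(X, D(h))` is a `Γ(X, W)`-algebra by restriction (Mathlib's `algebra_section_section_basicOpen`, transported to the
synonyms). [cite: GortzWedhorn2020, §(2.10) (principal open subschemes)] -/
instance instAlgebraBasicOpen (h : ChartRing f W) : Algebra (ChartRing f W) (ChartRing f (X.basicOpen (val h))) :=
  inferInstanceAs (Algebra Γ(X, W) Γ(X, X.basicOpen (val h)))

/-- Unfolding: the structure map `Γ(X, W) → Γ(X, D(h))` is the restriction. [cite: GortzWedhorn2020, §(2.10)] -/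
theorem val_algebraMap_basicOpen (h s : ChartRing f W) :
    val (algebraMap (ChartRing f W) (ChartRing f (X.basicOpen (val h))) s) =
      X.presheaf.map (homOfLE (X.basicOpen_le (val h))).op (val s) :=
  rfl

/-- `R → Γ(X, W) → Γ(X, D(h))` is a scalar tower (the structure maps are `f^♯` followed by restriction).
[cite: GortzWedhorn2020, §(2.10)] -/
instance instIsScalarTowerBasicOpen (h : ChartRing f W) :
    IsScalarTower R (ChartRing f W) (ChartRing f (X.basicOpen (val h))) :=
  IsScalarTower.of_algebraMap_eq fun r => val_injective f _ (by
    rw [val_algebraMap, val_algebraMap_basicOpen, val_algebraMap, appLE_map_apply])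

/-- **`Γ(X, D(h)) = Γ(X, W)[1/h]`** for an affine `W` (Mathlib `IsAffineOpen.isLocalization_basicOpen`).
[cite: GortzWedhorn2020, §(2.10) and Thm. 2.33] -/
theorem isLocalization_away (hW : IsAffineOpen W) (h : ChartRing f W) :
    IsLocalization.Away h (ChartRing f (X.basicOpen (val h))) :=
  hW.isLocalization_basicOpen (val h)

end ChartRing

/-- **The augmentations of `W` and of `D(h) ⊆ W` are compatible with the restriction.** [cite: GortzWedhorn2023, (17.3) and Remark 17.14] -/
theorem sectionAug_algebraMap (h : ChartRing f W) (hh : sectionAug f e he heW h = 1) (s : ChartRing f W) :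
    sectionAug f e he (preimage_basicOpen_eq_top f e he heW h hh)
        (algebraMap (ChartRing f W) (ChartRing f (X.basicOpen (val h))) s) =
      sectionAug f e he heW s := by
  rw [sectionAug_apply, sectionAug_apply, val_algebraMap_basicOpen, map_appLE_apply]

/-- A prime containing the kernel of a surjection `φ` is the pull-back of (its image,) a point of `Spec` of the target.
[folklore] -/
private theorem exists_comap_eq_of_ker_le {A B : Type u} [CommRing A] [CommRing B] (φ : A →+* B)
    (hφ : Function.Surjective φ) (𝔪 : Ideal A) [h𝔪 : 𝔪.IsMaximal] (hk : RingHom.ker φ ≤ 𝔪) :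
    ∃ y : PrimeSpectrum B, PrimeSpectrum.comap φ y = ⟨𝔪, h𝔪.isPrime⟩ := by
  have hcm : (𝔪.map φ).comap φ = 𝔪 := by
    rw [Ideal.comap_map_of_surjective φ hφ]
    exact le_antisymm (sup_le le_rfl fun x hx => hk ((RingHom.ker_eq_comap_bot φ).symm ▸ hx)) le_sup_left
  have hne : 𝔪.map φ ≠ ⊤ := fun htop => h𝔪.ne_top (by rw [← hcm, htop, Ideal.comap_top])
  haveI : (𝔪.map φ).IsPrime := ((Ideal.map_eq_top_or_isMaximal_of_surjective φ hφ h𝔪).resolve_left hne).isPrime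
  exact ⟨⟨𝔪.map φ, inferInstance⟩, PrimeSpectrum.ext hcm⟩

include he in
/-- **Every open neighbourhood of the section contains a basic open `D(h) ∋` the section, `e^♯(h) = 1`.**  For an affine
`W ⊇ e(Spec R)` and an open `O ⊇ e(Spec R)`: the section is the closed subset `V(I)` of `Spec Γ(X, W)`, `I = ker e^♯`
(`e^♯` is surjective, `e` being a section), the complement of `O` in `W` is `V(J)`, and `V(I) ∩ V(J) = ∅` gives
`i + j = 1` with `i ∈ I`, `j ∈ J`; then `h = j` has `e^♯(h) = 1` and `D(h) ∩ V(J) = ∅`, i.e. `D(h) ⊆ O`.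
[cite: GortzWedhorn2023, (17.3)] [cite: GortzWedhorn2020, §(2.10) and Prop. 3.33] -/
theorem exists_sectionAug_eq_one_and_basicOpen_le (hW : IsAffineOpen W) (O : X.Opens) (heO : e ⁻¹ᵁ O = ⊤) :
    ∃ h : ChartRing f W, sectionAug f e he heW h = 1 ∧ X.basicOpen (val h) ≤ O := by
  classical
  -- notation: `S = Γ(X, W)`, `ε' = e^♯ : S → Γ(Spec R, ⊤)`, `O' = fromSpec⁻¹ O ⊆ Spec S`, `J = I(O'ᶜ)`
  set ε' : Γ(X, W) ⟶ Γ(Spec (.of R), ⊤) := e.appLE W ⊤ heW.ge with hε'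
  have hsurj : Function.Surjective ε'.hom := fun x => ⟨f.appLE ⊤ W le_top x, appLE_section_apply f e he heW x⟩
  set O' : (Spec Γ(X, W)).Opens := hW.fromSpec ⁻¹ᵁ O with hO'
  set J : Ideal Γ(X, W) := PrimeSpectrum.vanishingIdeal ((O' : Set (Spec Γ(X, W)))ᶜ) with hJ
  -- `ker ε' + J = (1)`
  have htop : RingHom.ker ε'.hom ⊔ J = ⊤ := by
    by_contra hne
    obtain ⟨𝔪, h𝔪, hle⟩ := Ideal.exists_le_maximal _ hne
    obtain ⟨y, hy⟩ := exists_comap_eq_of_ker_le ε'.hom hsurj 𝔪 (le_sup_left.trans hle)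
    -- the point `𝔪` of `Spec S` is the image of the point `y` of `Spec Γ(Spec R, ⊤)`, hence maps into `O`
    have hx : hW.fromSpec (PrimeSpectrum.comap ε'.hom y) ∈ O := by
      rw [← Spec.map_apply, ← Scheme.Hom.comp_apply, hε',
        IsAffineOpen.SpecMap_appLE_fromSpec e hW (isAffineOpen_top _) heW.ge, Scheme.Hom.comp_apply]
      change (isAffineOpen_top (Spec (.of R))).fromSpec y ∈ e ⁻¹ᵁ O
      rw [heO]; trivial
    -- but `J ≤ 𝔪` says `𝔪 ∈ closure (O'ᶜ) = O'ᶜ`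
    have hx' : (⟨𝔪, h𝔪.isPrime⟩ : PrimeSpectrum Γ(X, W)) ∈ (O' : Set (Spec Γ(X, W)))ᶜ := by
      have hJ𝔪 : J ≤ 𝔪 := le_sup_right.trans hle
      have : (⟨𝔪, h𝔪.isPrime⟩ : PrimeSpectrum Γ(X, W)) ∈ PrimeSpectrum.zeroLocus (J : Set Γ(X, W)) := hJ𝔪
      rwa [hJ, PrimeSpectrum.zeroLocus_vanishingIdeal_eq_closure, O'.isOpen.isClosed_compl.closure_eq] at this
    rw [hy] at hx
    exact hx' hx
  obtain ⟨i, hi, j, hj, hij⟩ := Submodule.mem_sup.1 ((Ideal.eq_top_iff_one _).1 htop)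
  refine ⟨mk f W j, ?_, ?_⟩
  · -- `e^♯ j = e^♯ (1 - i) = 1`
    rw [sectionAug_apply, val_mk]
    have hj' : j = 1 - i := by rw [← hij]; ring
    change (Scheme.ΓSpecIso (.of R)).hom (ε' j) = 1
    rw [hj', map_sub, map_one, RingHom.mem_ker.1 hi, sub_zero, map_one]
  · -- `D(j) = fromSpec (D(j)) ⊆ fromSpec (O') ⊆ O`
    rw [val_mk, ← hW.fromSpec_image_basicOpen j]
    rintro _ ⟨z, hz, rfl⟩
    have hzO : z ∈ (O' : Set (Spec Γ(X, W))) := by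
      by_contra hzO
      have hjz : j ∈ z.asIdeal := (PrimeSpectrum.mem_vanishingIdeal _ _).1 hj z hzO
      exact (PrimeSpectrum.mem_basicOpen _ _).1 hz hjz
    exact hzO

/-! ## §3 The action of an endomorphism fixing the section on the conormal module -/

section Endo

variable (v : X ⟶ X) (hv : v ≫ f = f) (hev : e ≫ v = e) (h : ChartRing f W) (hhv : X.basicOpen (val h) ≤ v ⁻¹ᵁ W)

/-- **`v^♯ : Γ(X, W) → Γ(X, D(h))`** for an `R`-endomorphism `v` of `X` and a basic open `D(h) ⊆ v⁻¹W` of `W`, as an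
`R`-algebra map. [cite: GortzWedhorn2023, Remark 17.14] -/
def restrictAlgHom : ChartRing f W →ₐ[R] ChartRing f (X.basicOpen (val h)) where
  toRingHom := (mk f (X.basicOpen (val h))).comp ((v.appLE W (X.basicOpen (val h)) hhv).hom.comp val)
  commutes' r := val_injective f _ (by
    change v.appLE W (X.basicOpen (val h)) hhv (val (algebraMap R (ChartRing f W) r)) =
      val (algebraMap R (ChartRing f (X.basicOpen (val h))) r)
    rw [val_algebraMap, val_algebraMap, appLE_appLE_apply, appLE_congr_hom hv])

/-- Unfolding of `restrictAlgHom`. [cite: GortzWedhorn2023, Remark 17.14] -/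
theorem val_restrictAlgHom (s : ChartRing f W) :
    val (restrictAlgHom f v hv h hhv s) = v.appLE W (X.basicOpen (val h)) hhv (val s) :=
  rfl

include hev in
/-- **`v` fixes the section ⇒ `v^♯` is compatible with the augmentations**: `e^♯_{D(h)} ∘ v^♯ = e^♯_W`.
[cite: GortzWedhorn2023, Remark 17.14] -/
theorem sectionAug_restrictAlgHom (hh : sectionAug f e he heW h = 1) (s : ChartRing f W) :
    sectionAug f e he (preimage_basicOpen_eq_top f e he heW h hh) (restrictAlgHom f v hv h hhv s) =
      sectionAug f e he heW s := by
  rw [sectionAug_apply, sectionAug_apply, val_restrictAlgHom, appLE_appLE_apply, appLE_congr_hom hev]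

include hev in
/-- `v^♯` maps the augmentation ideal of `W` into that of `D(h)`. [cite: GortzWedhorn2023, Remark 17.14] -/
theorem augIdeal_le_comap_restrictAlgHom (hh : sectionAug f e he heW h = 1) :
    augIdeal (sectionAug f e he heW) ≤
      (augIdeal (sectionAug f e he (preimage_basicOpen_eq_top f e he heW h hh))).comap (restrictAlgHom f v hv h hhv) := by
  intro s hs
  rw [Ideal.mem_comap, mem_augIdeal_iff, sectionAug_restrictAlgHom f e he heW v hv hev h hhv hh]
  exact (mem_augIdeal_iff _ s).1 hs

/-- **The action of `v` on the conormal module `I/I²` of the section** (`v` an `R`-endomorphism of `X` with `e ≫ v = e`,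
`W` an affine chart of the section, `D(h) ⊆ W ∩ v⁻¹W` a basic open containing the section): the composite
`I/I² —v^♯→ I_h/I_h² ≅ I/I²` of `Ideal.mapCotangent v^♯` with the inverse of the localisation isomorphism
`augCotangentLocalizationEquiv` (Görtz–Wedhorn II, Remark 17.14, the map `w` of conormal sheaves, for the square
`e = v ∘ e`, read on the chart `W` through `D(h)`). [cite: GortzWedhorn2023, Remark 17.14 and (17.3)] -/
def sectionConormalEndo (hW : IsAffineOpen W) (hh : sectionAug f e he heW h = 1) :
    (augIdeal (sectionAug f e he heW)).Cotangent →ₗ[R] (augIdeal (sectionAug f e he heW)).Cotangent :=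
  haveI := ChartRing.isLocalization_away f hW h
  (augCotangentLocalizationEquiv (sectionAug f e he heW) (sectionAug f e he (preimage_basicOpen_eq_top f e he heW h hh))
      (sectionAug_algebraMap f e he heW h hh) h hh).symm.toLinearMap ∘ₗ
    (augIdeal (sectionAug f e he heW)).mapCotangent _ (restrictAlgHom f v hv h hhv)
      (augIdeal_le_comap_restrictAlgHom f e he heW v hv hev h hhv hh)

/-- **Defining property of `sectionConormalEndo`**: followed by the localisation isomorphism `I/I² ≅ I_h/I_h²` it is
`Ideal.mapCotangent v^♯`; on classes, `[s] ↦ γ [s]` with `[γ s]_h = [v^♯ s]_h`. [cite: GortzWedhorn2023, Remark 17.14] -/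
theorem augCotangentLocalizationEquiv_sectionConormalEndo (hW : IsAffineOpen W) (hh : sectionAug f e he heW h = 1)
    (x : (augIdeal (sectionAug f e he heW)).Cotangent) :
    haveI := ChartRing.isLocalization_away f hW h
    augCotangentLocalizationEquiv (sectionAug f e he heW) (sectionAug f e he (preimage_basicOpen_eq_top f e he heW h hh))
        (sectionAug_algebraMap f e he heW h hh) h hh (sectionConormalEndo f e he heW v hv hev h hhv hW hh x) =
      (augIdeal (sectionAug f e he heW)).mapCotangent _ (restrictAlgHom f v hv h hhv)
        (augIdeal_le_comap_restrictAlgHom f e he heW v hv hev h hhv hh) x := by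
  rw [sectionConormalEndo, LinearMap.comp_apply, LinearEquiv.coe_toLinearMap, LinearEquiv.apply_symm_apply]

end Endo

end Section


end Literature.AlgebraicGeometry.Morphisms

end
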